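import Literature.NumberTheory.Automorphic.WhittakerCoeffLocalDatum
import Literature.NumberTheory.Automorphic.SmoothedAutomorphicForms
import HarnessLib

/-!
# Whittaker coefficients of smoothed cuspidal vectors: the unramified datum at every good place

Topic `NumberTheory/Automorphic`; namespace `Literature.NumberTheory.Automorphic`. Sequel to
`WhittakerCoeffLocalDatum` (T1a) in the decomposition of the named fact
`StandardLFunctionData.multipliable_L` of `AutomorphicLFunction` (Jacquet–Shalika (1981),
Thm. (5.3)) by the real-point Rankin–Selberg / mean-square method. There the hypotheses on a function
`φ : GL_n(𝔸_K) → ℂ` under which `g_v ↦ W_φ(ι_v(g_v) g')` is an unramified Whittaker–Hecke datum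
were isolated: left `GL_n(K)`-invariance, right `ι_v(GL_n(𝒪_v))`-invariance, and the *pointwise*
Hecke equations over the transversal `{u_a ϖ^{ε_S}}` of `GL_n(𝒪_v) t_r GL_n(𝒪_v) / GL_n(𝒪_v)`.
This file **verifies these hypotheses** for the honest vectors of a cuspidal automorphic
representation `Π ⊆ L²(GL_n(𝔸_K) ⧸ A_G GL_n(K), μ)` (`CuspidalAutomorphicRepGL`) with a Satake family
`α` off `S` (`IsSatakeFamilyOf`): for the continuous smoothed form `S_η f` of
`SmoothedAutomorphicForms` (`f ∈ Π^{K(𝔫₀)}`, `η` a left `K(𝔫₀)`-invariant weight) read as the left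
invariant function `φ = invQuot (S_η f) : g ↦ S_η f [g⁻¹]` (Borel–Jacquet's convention, `AutomorphicForms`),
and every `v ∉ S`, `v ∤ 𝔫₀`:

* `invQuot_mul_ofLocal_of_mem_glInt` — `φ(y ι_v(k)) = φ(y)` for `k ∈ GL_n(𝒪_v)` (`K(𝔫₀)` is maximal
  at `v`, `smoothedForm_smul`);
* `sum_invQuot_smoothedForm_mul_ofLocal_rep_eq` — **the pointwise Hecke equations**
  `∑_{(S,ā)} φ(y ι_v(u_a ϖ^{ε_S})) = q_v^{r(n-r)/2} e_r(x) φ(y)` for `1 ≤ r ≤ n`, `x` any enumeration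
  of `α v`, `ϖ` the uniformizer of the Satake datum (`heckeOperatorAt_eq_satake_smul` of
  `SmoothedAutomorphicForms` at level `K(𝔫₀)`; level change to the local spherical level
  `ι_v(GL_n(𝒪_v))`, `heckeOperatorAt_ofLocal_apply_eq_of_le`; the local transversal transported
  along `ι_v`, `bijOn_heckeTransversal` and `bijOn_image_map`; pointwise by
  `sum_smoothedForm_inv_smul_eq`);
* `integrableOn_whittakerIntegrand_of_continuous` — the Whittaker integrands of a continuous `φ` are
  integrable on a relatively compact `𝓕` for a measure finite on compacts;
* `isUnramifiedWhittakerDatum_whittakerCoeff_smoothedForm` (**assembly**): for such `Π, f, η, v` and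
  every `g'` with `g'_v = 1`, `g_v ↦ W_φ(ι_v(g_v) g')` is an `IsUnramifiedWhittakerDatum` with
  parameters `(√q_v, x)`; hence (`whittakerCoeff_smoothedForm_ofLocal_piPowGL_eq`) Shintani's formula
  `W_φ(ι_v(ϖ^μ) g') = q_v^{-b(μ)/2} s_μ(x) W_φ(g')` whenever `ψ_v` has conductor `𝒪_v` and
  `#𝓀_v = q_v`.

Everything is proved; no definition and no named fact is introduced. The two numerical side
conditions of the last statement (`ψ_v` unramified at `v`, which holds off a finite set by
`Tate1950_adicComponent_adeleAddChar` of `GlobalAdditiveCharacter`, and `#𝓀_v = q_v`, cf.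
`residueFieldCard_adicCompletion_le` of `SatakeParameterGenericBound`) are kept as hypotheses.

## References

* H. Jacquet, J. A. Shalika, *On Euler products and the classification of automorphic
  representations I*, Amer. J. Math. 103 (1981), §2, §5 [JacquetShalikaAJM1981].
* J. W. Cogdell, *Analytic theory of L-functions for GL_n*, in: *An Introduction to the Langlands
  Program* (2004), §1.1, §3 [CogdellAnalyticTheory2004].
* A. Borel, H. Jacquet, *Automorphic forms and automorphic representations*, Corvallis (1979),
  §4.2–4.6 [BorelJacquet1979].
-/

noncomputable section

open scoped MatrixGroups ComplexConjugate
open NumberField IsDedekindDomain MeasureTheory Matrix ValuativeRel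
open Literature.RingTheory.SymmetricFunctions.SymmPoly

namespace Literature.NumberTheory.Automorphic

/-! ### Local bookkeeping: the Hecke element and the spherical level at `v` -/

section Local

variable (n : ℕ) {K : Type} [Field K] [NumberField K] (v : HeightOneSpectrum (𝓞 K))

/-- The local Hecke element `heckeDiag n ϖ r = diag(ϖ,…,ϖ,1,…,1)` of `SatakeParametersGL` is the
diagonal element `glDiagonal` with the same entries (so that `heckeDiagAt_eq_ofLocal_glDiagonal`
reads `t_{v,r} = ι_v(heckeDiag n ϖ r)`). [folklore] -/
theorem glDiagonal_eq_heckeDiag (ϖ : (v.adicCompletion K)ˣ) (r : ℕ) :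
    glDiagonal n (v.adicCompletion K) (fun k => if (k : ℕ) < r then ϖ else 1) = heckeDiag n ϖ r := by
  refine Matrix.GeneralLinearGroup.ext fun i j => ?_
  rw [coe_glDiagonal, coe_heckeDiag]
  congr 1
  funext k
  split_ifs <;> rfl

/-- The local spherical level `ι_v(GL_n(𝒪_v))`, written with `glInt` of `ReductiveGroupData`, is
contained in `K(𝔫₀)` for `v ∤ 𝔫₀ ≠ 0` (`isMaximalAt_principalCongruenceLevel` through the dictionary
`glInt_adicCompletion_eq`). [folklore] -/
theorem map_ofLocal_glInt_le_principalCongruenceLevel {𝔫₀ : Ideal (𝓞 K)} (h𝔫₀ : 𝔫₀ ≠ 0)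
    (hv : ¬ v.asIdeal ∣ 𝔫₀) :
    (glInt n (v.adicCompletion K)).map (GLn.ofLocal n K v) ≤ principalCongruenceLevel n K 𝔫₀ := by
  rw [glInt_adicCompletion_eq]
  exact isMaximalAt_principalCongruenceLevel n K v h𝔫₀ hv

/-- `ι_v(GL_n(𝒪_v))` is maximal at `v` (tautologically). [folklore] -/
theorem isMaximalAt_map_ofLocal_glInt :
    IsMaximalAt n K v ((glInt n (v.adicCompletion K)).map (GLn.ofLocal n K v)) := by
  rw [IsMaximalAt, glInt_adicCompletion_eq]

end Local

/-! ### The smoothed form as a left-invariant function on `GL_n(𝔸_K)` -/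

section Smoothed

variable {n : ℕ} {K : Type} [Field K] [NumberField K]
  {μ : Measure (AdelicGroupData.gl n K).automorphicQuotient}
  [(AdelicGroupData.gl n K).IsAutomorphicMeasure μ]

omit [(AdelicGroupData.gl n K).IsAutomorphicMeasure μ] in
/-- `invQuot Φ (y z) = Φ (z⁻¹ • [y⁻¹])`: right translation of the left-invariant function is the
action on the quotient (the `invQuot` dictionary of `AutomorphicForms`). [folklore] -/
theorem invQuot_mul_eq_smul (Φ : (AdelicGroupData.gl n K).automorphicQuotient → ℂ)
    (y z : (AdelicGroupData.gl n K).Adelic) :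
    invQuot (AdelicGroupData.gl n K) Φ (y * z) =
      Φ (z⁻¹ • (AdelicGroupData.gl n K).toAutomorphicQuotient y⁻¹) := by
  rw [invQuot_apply, _root_.mul_inv_rev]
  rfl

omit [(AdelicGroupData.gl n K).IsAutomorphicMeasure μ] in
/-- **Right `ι_v(GL_n(𝒪_v))`-invariance of the smoothed form.** For `η` left `K(𝔫₀)`-invariant and
`v ∤ 𝔫₀ ≠ 0`, `φ = invQuot (S_η f)` satisfies `φ(y ι_v(k)) = φ(y)` for `k ∈ GL_n(𝒪_v)`
(`smoothedForm_smul`, `K(𝔫₀) ⊇ ι_v(GL_n(𝒪_v))`). [folklore] -/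
theorem invQuot_smoothedForm_mul_ofLocal {𝔫₀ : Ideal (𝓞 K)} (h𝔫₀ : 𝔫₀ ≠ 0)
    {v : HeightOneSpectrum (𝓞 K)} (hv : ¬ v.asIdeal ∣ 𝔫₀)
    {η : (AdelicGroupData.gl n K).Adelic → ℝ}
    (hηK : ∀ k : (AdelicGroupData.gl n K).Adelic, k ∈ principalCongruenceLevel n K 𝔫₀ →
      ∀ g : (AdelicGroupData.gl n K).Adelic, η (k * g) = η g)
    (f : (AdelicGroupData.gl n K).L2 μ) {k : GL (Fin n) (v.adicCompletion K)}
    (hk : k ∈ glInt n (v.adicCompletion K)) (y : GL (Fin n) (AdeleRing (𝓞 K) K)) :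
    invQuot (AdelicGroupData.gl n K) (smoothedForm η f) (y * GLn.ofLocal n K v k) =
      invQuot (AdelicGroupData.gl n K) (smoothedForm η f) y := by
  have hmem : (GLn.ofLocal n K v k)⁻¹ ∈ principalCongruenceLevel n K 𝔫₀ :=
    Subgroup.inv_mem _ (map_ofLocal_glInt_le_principalCongruenceLevel n v h𝔫₀ hv ⟨k, hk, rfl⟩)
  exact (invQuot_mul_eq_smul _ y _).trans
    ((smoothedForm_smul hηK f hmem _).trans (invQuot_apply _ _ _).symm)

/-- **The pointwise Hecke equations for the smoothed form at a good place.** Let `Π` be cuspidal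
with Satake family `α` off `S`, `f ∈ Π`, `η` a continuous compactly supported left
`K(𝔫₀)`-invariant weight (`𝔫₀ ≠ 0`), `v ∉ S` with `v ∤ 𝔫₀`, and `x` an enumeration of `α v`. Then for
the uniformizer `ϖ` of the Satake datum at `v` (`|ϖ|_v = exp(-1)`), the left-invariant continuous
function `φ = invQuot (S_η f)` satisfies, for `1 ≤ r ≤ n` and every `y ∈ GL_n(𝔸_K)`,
`∑_{(S,ā)} φ(y ι_v(u_a ϖ^{ε_S})) = q_v^{r(n-r)/2} e_r(x) φ(y)`, the sum over the transversal of
`GL_n(𝒪_v) t_r GL_n(𝒪_v) / GL_n(𝒪_v)` of `HeckeTransversalGL`: the smoothed vector is a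
`T_{v,r}`-eigenvector at level `K(𝔫₀)` (`heckeOperatorAt_eq_satake_smul`), hence at the local
spherical level `ι_v(GL_n(𝒪_v))` (`heckeOperatorAt_ofLocal_apply_eq_of_le`), whose double coset
`ι_v(GL_n(𝒪_v)) ι_v(t_r) ι_v(GL_n(𝒪_v))` is the image of the local one with the image transversal
(`bijOn_heckeTransversal`, `bijOn_image_map`); `sum_smoothedForm_inv_smul_eq` makes the operator
identity pointwise for the continuous representative. [folklore] -/
theorem sum_invQuot_smoothedForm_mul_ofLocal_rep_eq (P : CuspidalAutomorphicRepGL n K μ)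
    {S : Set (HeightOneSpectrum (𝓞 K))} {α : SatakeFamily K} (hα : IsSatakeFamilyOf P S α)
    {𝔫₀ : Ideal (𝓞 K)} (h𝔫₀ : 𝔫₀ ≠ 0) {v : HeightOneSpectrum (𝓞 K)} (hvS : v ∉ S)
    (hv : ¬ v.asIdeal ∣ 𝔫₀) {η : (AdelicGroupData.gl n K).Adelic → ℝ} (hη : Continuous η)
    (hηs : HasCompactSupport η)
    (hηK : ∀ k : (AdelicGroupData.gl n K).Adelic, k ∈ principalCongruenceLevel n K 𝔫₀ →
      ∀ g : (AdelicGroupData.gl n K).Adelic, η (k * g) = η g)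
    (f : P.1.toSubmodule) {x : Fin n → ℂ} (hx : (Finset.univ : Finset (Fin n)).val.map x = α v) :
    ∃ (ϖ : (v.adicCompletion K)ˣ) (hϖ : Valued.v (ϖ : v.adicCompletion K) = WithZero.exp (-1 : ℤ)),
      ∀ r, 1 ≤ r → r ≤ n → ∀ y : GL (Fin n) (AdeleRing (𝓞 K) K),
        ∑ p : TransversalIndex n (v.adicCompletion K) r,
            invQuot (AdelicGroupData.gl n K) (smoothedForm η (f : (AdelicGroupData.gl n K).L2 μ))
              (y * GLn.ofLocal n K v (p.rep (isUniformizingElement_of_valued_eq K v hϖ).ne_zero)) =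
          (((Real.sqrt (v.residueCard : ℝ) : ℝ) : ℂ)) ^ (r * (n - r)) * esymm x r *
            invQuot (AdelicGroupData.gl n K)
              (smoothedForm η (f : (AdelicGroupData.gl n K).L2 μ)) y := by
  classical
  -- the smoothed vector, `K(𝔫₀)`-fixed, and its Hecke eigenvalues at level `K(𝔫₀)`
  set sv := smoothedVector P.1 η f with hsv
  have hsvK : sv ∈ P.1.fixedVectors (principalCongruenceLevel n K 𝔫₀) :=
    smoothedVector_mem_fixedVectors P.1 hη hηs hηK f
  obtain ⟨ϖ, hϖ, heig⟩ := heckeOperatorAt_eq_satake_smul P hα h𝔫₀ hvS hv hsvK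
  refine ⟨ϖ, hϖ, fun r _ hrn y => ?_⟩
  have hϖ' : IsUniformizingElement (ϖ : v.adicCompletion K) :=
    isUniformizingElement_of_valued_eq K v hϖ
  -- the local spherical level `ι_v(GL_n(𝒪_v))` and the eigenvalue equation there
  have hle : (glInt n (v.adicCompletion K)).map (GLn.ofLocal n K v) ≤
      principalCongruenceLevel n K 𝔫₀ :=
    map_ofLocal_glInt_le_principalCongruenceLevel n v h𝔫₀ hv
  have hsvKf : sv ∈ P.1.fixedVectors ((glInt n (v.adicCompletion K)).map (GLn.ofLocal n K v)) :=
    P.1.fixedVectors_antitone hle hsvK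
  have ht : heckeDiagAt n K v ϖ r = GLn.ofLocal n K v (heckeDiag n ϖ r) := by
    rw [heckeDiagAt_eq_ofLocal_glDiagonal, glDiagonal_eq_heckeDiag]
  set c : ℂ := (((Real.sqrt (v.residueCard : ℝ) : ℝ) : ℂ)) ^ (r * (n - r)) * (α v).esymm r with hc
  have heigKf : heckeOperatorAt P.1 ((glInt n (v.adicCompletion K)).map (GLn.ofLocal n K v))
      (GLn.ofLocal n K v (heckeDiag n ϖ r)) sv = c • sv :=
    (heckeOperatorAt_ofLocal_apply_eq_of_le P.1 hle (isMaximalAt_map_ofLocal_glInt n v)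
      (principalCongruenceLevel_le n K 𝔫₀) _ hsvK).trans (by rw [← ht]; exact heig r hrn)
  -- the local transversal and its image under `ι_v`
  have hbij := bijOn_heckeTransversal (n := n) hϖ' hrn
  rw [Units.mk0_val] at hbij
  have hs := bijOn_image_map (GLn.ofLocal n K v) GLn.ofLocal_injective (glInt n (v.adicCompletion K))
    (heckeDiag n ϖ r) (heckeTransversal (n := n) hϖ'.ne_zero r) hbij
  -- the point `[y⁻¹]` and the pointwise Hecke equation of the continuous smoothed form
  set yA : (AdelicGroupData.gl n K).Adelic := y with hyA
  set X : (AdelicGroupData.gl n K).automorphicQuotient :=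
    (AdelicGroupData.gl n K).toAutomorphicQuotient yA⁻¹ with hX
  set F : (AdelicGroupData.gl n K).Adelic → ℂ := fun z =>
    smoothedForm η (f : (AdelicGroupData.gl n K).L2 μ) (z⁻¹ • X) with hF
  have hpt : ∑ z ∈ (heckeTransversal (n := n) hϖ'.ne_zero r).image (GLn.ofLocal n K v), F z =
      c * smoothedForm η (f : (AdelicGroupData.gl n K).L2 μ) X :=
    sum_smoothedForm_inv_smul_eq P.1 hη hηs f (GLn.ofLocal n K v (heckeDiag n ϖ r)) _ hs hsvKf
      heigKf X
  have e1 : ∑ z ∈ (heckeTransversal (n := n) hϖ'.ne_zero r).image (GLn.ofLocal n K v), F z =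
      ∑ w ∈ heckeTransversal (n := n) hϖ'.ne_zero r, F (GLn.ofLocal n K v w) :=
    Finset.sum_image fun a _ b _ hab => GLn.ofLocal_injective hab
  have e2 : ∑ p : TransversalIndex n (v.adicCompletion K) r, F (GLn.ofLocal n K v (p.rep hϖ'.ne_zero)) =
      c * smoothedForm η (f : (AdelicGroupData.gl n K).L2 μ) X :=
    ((sum_heckeTransversal hϖ' r fun w => F (GLn.ofLocal n K v w)).symm.trans e1.symm).trans hpt
  -- assemble
  calc ∑ p : TransversalIndex n (v.adicCompletion K) r,
        invQuot (AdelicGroupData.gl n K) (smoothedForm η (f : (AdelicGroupData.gl n K).L2 μ))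
          (y * GLn.ofLocal n K v (p.rep hϖ'.ne_zero))
        = ∑ p : TransversalIndex n (v.adicCompletion K) r, F (GLn.ofLocal n K v (p.rep hϖ'.ne_zero)) :=
        Finset.sum_congr rfl fun p _ => invQuot_mul_eq_smul _ yA _
    _ = c * smoothedForm η (f : (AdelicGroupData.gl n K).L2 μ) X := e2
    _ = (((Real.sqrt (v.residueCard : ℝ) : ℝ) : ℂ)) ^ (r * (n - r)) * esymm x r *
          invQuot (AdelicGroupData.gl n K) (smoothedForm η (f : (AdelicGroupData.gl n K).L2 μ)) y := by
        rw [hc, ← hx, ← esymm_eq_multiset_esymm, invQuot_apply]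

end Smoothed

/-! ### Integrability of the Whittaker integrands of a continuous function -/

section Integrable

variable {n : ℕ} {K : Type} [Field K] [NumberField K]

/-- The generic character `u ↦ ψ_U(u)` of `N_n(𝔸_K)` is continuous for a continuous `ψ`.
[folklore] -/
theorem continuous_whittakerCharFun {ψ : AddChar (AdeleRing (𝓞 K) K) Circle} (hψ : Continuous ψ) :
    Continuous fun u : ↥(adelicUnipotent n K) => whittakerCharFun ψ u := by
  have hval : Continuous fun u : ↥(adelicUnipotent n K) =>
      ((u : GL (Fin n) (AdeleRing (𝓞 K) K)) : Matrix (Fin n) (Fin n) (AdeleRing (𝓞 K) K)) :=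
    Units.continuous_val.comp continuous_subtype_val
  have hsum : Continuous fun u : ↥(adelicUnipotent n K) => superdiagSum u := by
    simp only [superdiagSum_def]
    refine continuous_finsetSum _ fun i _ => continuous_finsetSum _ fun j _ => ?_
    split_ifs
    · exact hval.matrix_elem i j
    · exact continuous_const
  simp only [whittakerCharFun_apply]
  exact continuous_subtype_val.comp (hψ.comp hsum)

/-- **The Whittaker integrands of a continuous function are integrable on a relatively compact
fundamental domain**: for `φ : GL_n(𝔸_K) → ℂ` continuous, `ψ` continuous and `𝓕 ⊆ N_n(𝔸_K)` with
compact closure, `u ↦ φ(u g) ψ̄(u)` is integrable on `𝓕` for every measure finite on compact sets.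
[folklore] -/
theorem integrableOn_whittakerIntegrand_of_continuous [MeasurableSpace ↥(adelicUnipotent n K)]
    [BorelSpace ↥(adelicUnipotent n K)] {ν : Measure ↥(adelicUnipotent n K)}
    [IsFiniteMeasureOnCompacts ν] {𝓕 : Set ↥(adelicUnipotent n K)} (h𝓕 : IsCompact (closure 𝓕))
    {ψ : AddChar (AdeleRing (𝓞 K) K) Circle} (hψ : Continuous ψ)
    {φ : GL (Fin n) (AdeleRing (𝓞 K) K) → ℂ} (hφ : Continuous φ) (g : GL (Fin n) (AdeleRing (𝓞 K) K)) :
    IntegrableOn (fun u : ↥(adelicUnipotent n K) =>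
      φ ((u : GL (Fin n) (AdeleRing (𝓞 K) K)) * g) * conj (whittakerCharFun ψ u)) 𝓕 ν := by
  have hc : Continuous fun u : ↥(adelicUnipotent n K) =>
      φ ((u : GL (Fin n) (AdeleRing (𝓞 K) K)) * g) * conj (whittakerCharFun ψ u) :=
    (hφ.comp (continuous_subtype_val.mul continuous_const)).mul
      (Complex.continuous_conj.comp (continuous_whittakerCharFun hψ))
  -- bounded on the compact closure, which has finite measure
  obtain ⟨M, hM⟩ := h𝓕.exists_bound_of_continuousOn hc.continuousOn
  refine Measure.integrableOn_of_bounded (M := M) ?_ hc.aestronglyMeasurable ?_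
  · exact ((measure_mono subset_closure).trans_lt h𝓕.measure_lt_top).ne
  · exact (ae_restrict_iff' measurableSet_closure).2 (Filter.Eventually.of_forall hM) |>.filter_mono
      (ae_mono (Measure.restrict_mono subset_closure le_rfl))

end Integrable

/-! ### Assembly: the unramified datum of a smoothed cuspidal vector -/

section Assembly

variable {n : ℕ} {K : Type} [Field K] [NumberField K]
  {μ : Measure (AdelicGroupData.gl n K).automorphicQuotient}
  [(AdelicGroupData.gl n K).IsAutomorphicMeasure μ]
/-- The smoothed form read on `GL_n(𝔸_K)` is continuous. [folklore] -/
theorem continuous_invQuot_smoothedForm {η : (AdelicGroupData.gl n K).Adelic → ℝ} (hη : Continuous η)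
    (hηs : HasCompactSupport η) (f : (AdelicGroupData.gl n K).L2 μ) :
    Continuous (invQuot (AdelicGroupData.gl n K) (smoothedForm η f)) :=
  (continuous_smoothedForm hη hηs f).comp
    ((AdelicGroupData.gl n K).continuous_toAutomorphicQuotient.comp continuous_inv)

variable [MeasurableSpace ↥(adelicUnipotent n K)] [BorelSpace ↥(adelicUnipotent n K)]
  [Countable ↥(rationalUnipotent n K)]
  [MeasurableConstSMul ↥(rationalUnipotent n K) ↥(adelicUnipotent n K)]
  {ν : Measure ↥(adelicUnipotent n K)} [IsFiniteMeasureOnCompacts ν]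
  [SMulInvariantMeasure ↥(rationalUnipotent n K) ↥(adelicUnipotent n K) ν] [ν.IsMulRightInvariant]
  {𝓕 : Set ↥(adelicUnipotent n K)} {ψ : AddChar (AdeleRing (𝓞 K) K) Circle}

/-- **The unramified Whittaker–Hecke datum of a smoothed cuspidal vector.** Let `Π` be a cuspidal
automorphic representation of `GL_n(𝔸_K)` with Satake family `α` off `S`, `f ∈ Π`, `η` a continuous
compactly supported left `K(𝔫₀)`-invariant weight (`𝔫₀ ≠ 0`), `φ = invQuot (S_η f)` the associated
left-invariant continuous function, `v ∉ S` with `v ∤ 𝔫₀`, `x` an enumeration of `α v`; let `ψ` be a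
global additive character, `𝓕` a relatively compact measurable fundamental domain of `N_n(K)` in
`N_n(𝔸_K)` for a right-invariant measure `ν` finite on compacts, and `g' ∈ GL_n(𝔸_K)` with
`g'_v = 1`. Then for the uniformizer `ϖ` of the Satake datum, `g_v ↦ W_φ(ι_v(g_v) g')` is an
unramified Whittaker–Hecke datum for `ψ_v` with parameters `(√q_v, x)` — the input of Shintani's
formula (`WhittakerCoeffLocalDatum`) at every good place, for honest `L²`-cuspidal `Π`
(Jacquet–Shalika (1981), §2 and §5; Cogdell (2004), §3). [folklore] -/
theorem isUnramifiedWhittakerDatum_whittakerCoeff_smoothedForm (P : CuspidalAutomorphicRepGL n K μ)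
    {S : Set (HeightOneSpectrum (𝓞 K))} {α : SatakeFamily K} (hα : IsSatakeFamilyOf P S α)
    {𝔫₀ : Ideal (𝓞 K)} (h𝔫₀ : 𝔫₀ ≠ 0) {v : HeightOneSpectrum (𝓞 K)} (hvS : v ∉ S)
    (hv : ¬ v.asIdeal ∣ 𝔫₀) {η : (AdelicGroupData.gl n K).Adelic → ℝ} (hη : Continuous η)
    (hηs : HasCompactSupport η)
    (hηK : ∀ k : (AdelicGroupData.gl n K).Adelic, k ∈ principalCongruenceLevel n K 𝔫₀ →
      ∀ g : (AdelicGroupData.gl n K).Adelic, η (k * g) = η g)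
    (f : P.1.toSubmodule) {x : Fin n → ℂ} (hx : (Finset.univ : Finset (Fin n)).val.map x = α v)
    (h𝓕 : IsFundamentalDomain ↥(rationalUnipotent n K) 𝓕 ν) (h𝓕c : IsCompact (closure 𝓕))
    (hψ : IsGlobalAddChar K ψ) {g' : GL (Fin n) (AdeleRing (𝓞 K) K)}
    (hg' : Matrix.GeneralLinearGroup.map (AdelicGroupData.adeleEval K v) g' = 1) :
    ∃ (ϖ : (v.adicCompletion K)ˣ) (hϖ : Valued.v (ϖ : v.adicCompletion K) = WithZero.exp (-1 : ℤ)),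
      IsUnramifiedWhittakerDatum (isUniformizingElement_of_valued_eq K v hϖ) (ψ.adicComponent v)
        (fun y => whittakerCoeff ν 𝓕 ψ
          (invQuot (AdelicGroupData.gl n K) (smoothedForm η (f : (AdelicGroupData.gl n K).L2 μ)))
          (GLn.ofLocal n K v y * g'))
        (((Real.sqrt (v.residueCard : ℝ) : ℝ) : ℂ)) x := by
  obtain ⟨ϖ, hϖ, hT⟩ := sum_invQuot_smoothedForm_mul_ofLocal_rep_eq P hα h𝔫₀ hvS hv hη hηs hηK f hx
  refine ⟨ϖ, hϖ, isUnramifiedWhittakerDatum_whittakerCoeff_ofLocal h𝓕 hψ (isLeftInvariant_invQuot _ _)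
    (fun k hk y => invQuot_smoothedForm_mul_ofLocal h𝔫₀ hv hηK _ hk y) _ hT
    (integrableOn_whittakerIntegrand_of_continuous h𝓕c hψ.continuous
      (continuous_invQuot_smoothedForm hη hηs _)) hg'⟩

/-- **Shintani's formula for the Whittaker coefficients of smoothed cuspidal vectors.** In the
situation of `isUnramifiedWhittakerDatum_whittakerCoeff_smoothedForm`, assume that the local
component `ψ_v` has conductor `𝒪_v` (trivial on `𝒪_v`, not on `ϖ⁻¹𝒪_v`, for every uniformizer of
the adelic normalisation) and that `#𝓀_v = q_v`. Then for the uniformizer `ϖ` of the Satake datum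
and every antitone `μ ∈ ℕⁿ`,
`W_φ(ι_v(ϖ^μ) g') = (√q_v)^{-b(μ)} s_μ(x) W_φ(g')`, and `W_φ(ι_v(ϖ^ν) g') = 0` for non-antitone `ν`
(Jacquet–Shalika (1981), §2; Cogdell (2004), Thm. 3.3, for the honest global coefficient).
[cite: Shintani1976, Theorem (p. 181)] -/
theorem whittakerCoeff_smoothedForm_ofLocal_piPowGL_eq (P : CuspidalAutomorphicRepGL n K μ)
    {S : Set (HeightOneSpectrum (𝓞 K))} {α : SatakeFamily K} (hα : IsSatakeFamilyOf P S α)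
    {𝔫₀ : Ideal (𝓞 K)} (h𝔫₀ : 𝔫₀ ≠ 0) {v : HeightOneSpectrum (𝓞 K)} (hvS : v ∉ S)
    (hv : ¬ v.asIdeal ∣ 𝔫₀) {η : (AdelicGroupData.gl n K).Adelic → ℝ} (hη : Continuous η)
    (hηs : HasCompactSupport η)
    (hηK : ∀ k : (AdelicGroupData.gl n K).Adelic, k ∈ principalCongruenceLevel n K 𝔫₀ →
      ∀ g : (AdelicGroupData.gl n K).Adelic, η (k * g) = η g)
    (f : P.1.toSubmodule) {x : Fin n → ℂ} (hx : (Finset.univ : Finset (Fin n)).val.map x = α v)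
    (h𝓕 : IsFundamentalDomain ↥(rationalUnipotent n K) 𝓕 ν) (h𝓕c : IsCompact (closure 𝓕))
    (hψ : IsGlobalAddChar K ψ) {g' : GL (Fin n) (AdeleRing (𝓞 K) K)}
    (hg' : Matrix.GeneralLinearGroup.map (AdelicGroupData.adeleEval K v) g' = 1)
    (hψv : ∀ c ∈ 𝒪[v.adicCompletion K], ψ.adicComponent v c = 1)
    (hψv' : ∀ ϖ : v.adicCompletion K, Valued.v ϖ = WithZero.exp (-1 : ℤ) →
      ∃ c ∈ 𝒪[v.adicCompletion K], ψ.adicComponent v (ϖ⁻¹ * c) ≠ 1)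
    (hq : Nat.card 𝓀[v.adicCompletion K] = v.residueCard) :
    ∃ (ϖ : (v.adicCompletion K)ˣ) (hϖ : Valued.v (ϖ : v.adicCompletion K) = WithZero.exp (-1 : ℤ)),
      (∀ {mu : Fin n → ℕ}, Antitone mu →
        whittakerCoeff ν 𝓕 ψ
            (invQuot (AdelicGroupData.gl n K) (smoothedForm η (f : (AdelicGroupData.gl n K).L2 μ)))
            (GLn.ofLocal n K v (piPowGL (isUniformizingElement_of_valued_eq K v hϖ).ne_zero mu) * g') =
          (((Real.sqrt (v.residueCard : ℝ) : ℝ) : ℂ)) ^ (-torusExponent mu) * schur x mu *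
            whittakerCoeff ν 𝓕 ψ
              (invQuot (AdelicGroupData.gl n K) (smoothedForm η (f : (AdelicGroupData.gl n K).L2 μ)))
              g') ∧
      (∀ {nu : Fin n → ℕ}, ¬ Antitone nu →
        whittakerCoeff ν 𝓕 ψ
            (invQuot (AdelicGroupData.gl n K) (smoothedForm η (f : (AdelicGroupData.gl n K).L2 μ)))
            (GLn.ofLocal n K v (piPowGL (isUniformizingElement_of_valued_eq K v hϖ).ne_zero nu) * g') =
          0) := by
  obtain ⟨ϖ, hϖ, hD⟩ := isUnramifiedWhittakerDatum_whittakerCoeff_smoothedForm P hα h𝔫₀ hvS hv hη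
    hηs hηK f hx h𝓕 h𝓕c hψ hg'
  have hs : (((Real.sqrt (v.residueCard : ℝ) : ℝ) : ℂ)) ≠ 0 := by
    rw [Complex.ofReal_ne_zero, Real.sqrt_ne_zero']
    exact_mod_cast zero_lt_one.trans v.one_lt_residueCard
  have hq' : ((Nat.card 𝓀[v.adicCompletion K] : ℕ) : ℂ) =
      (((Real.sqrt (v.residueCard : ℝ) : ℝ) : ℂ)) ^ 2 := by
    rw [hq, ← Complex.ofReal_pow, Real.sq_sqrt (Nat.cast_nonneg _), Complex.ofReal_natCast]
  obtain ⟨c, hc, hcne⟩ := hψv' ϖ hϖ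
  refine ⟨ϖ, hϖ, fun hmu => ?_, fun hnu => ?_⟩
  · have h := apply_piPowGL_eq_schur_mul hψv ⟨c, hc, hcne⟩ hD hs hq' hmu
    simpa only [map_one, one_mul] using h
  · exact apply_piPowGL_eq_zero_of_not_antitone
      (W := fun y => whittakerCoeff ν 𝓕 ψ (invQuot (AdelicGroupData.gl n K)
        (smoothedForm η (f : (AdelicGroupData.gl n K).L2 μ))) (GLn.ofLocal n K v y * g'))
      (isUniformizingElement_of_valued_eq K v hϖ) ⟨c, hc, hcne⟩ hD.equivariant hD.spherical hnu

end Assembly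

end Literature.NumberTheory.Automorphic
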